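import Literature.NumberTheory.DiophantineGeometry.SchurWeylPlethysmKroneckerBoundProofs
import Literature.NumberTheory.DiophantineGeometry.SchurWeylPlethysmTensorHighestWeightProofs
import Literature.NumberTheory.DiophantineGeometry.GLHighestWeightExistsUniqueProofs
import HarnessLib

/-!
# The dot product on the word model `(k^N)^{⊗D}`: nondegeneracy on highest-weight spaces,
# highest-weight vectors of stable subspaces, and symmetric `GL_N`-equivariant matrices

In the coordinate ("words") model `wordRep k N D` of `E^{⊗D}`, `E = k^N` (`TensorWordModel`), the
standard dot product `x ⬝ᵥ y = ∑_w x(w) y(w)` is invariant under the permutations of the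
positions (`dotProduct_wordPerm`) and has adjoint `g ↦ gᵀ` for the `GL_N`-action
(`dotProduct_wordRep`). This file proves, in characteristic zero:

* `eq_zero_of_forall_dotProduct_eq_zero`: the dot product is NONDEGENERATE on every
  highest-weight space `HW_μ = highestWeightSpace (wordRep k N D) (Weight.ofPartition N μ)`
  (`μ ⊢ D` with at most `N` parts): its radical is an `𝔖_D`-submodule of `HW_μ ≅ S^μ`
  (`spechtEquivHw`), which is irreducible (`isIrreducible_spechtRep_holds`), and it is proper
  because the polytabloid `e_T` of the row-reading tableau has `⟨e_T, e_T⟩ = |C_T| ≠ 0`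
  (`StdFilling.polytabloid_dotProduct_self_ne_zero`);
* `exists_mem_highestWeightSpace_of_le_comap`: every nonzero `GL_N`-stable subspace of the word
  model contains a nonzero highest-weight vector (the word model is a polynomial representation,
  `isPolynomialRep_wordRep`, so the tree's Lie–Kolchin-type existence theorem
  `exists_hasHighestWeight_of_isRationalRep` applies to the subrepresentation), and
  `exists_partition_of_highestWeightSpace_ne_bot`: its weight is `Weight.ofPartition N μ` for a
  partition `μ ⊢ D` with at most `N` parts;
* `IsGLCommuting.exists_mulVec_ne_zero`: a nonzero SYMMETRIC matrix `M` on words commuting with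
  all Kronecker powers `g^{⊗D}` (`IsGLCommuting`) moves some vector of some `HW_μ` — the
  elementary substitute, sufficient for an upper bound, for "`End_{GL(E)}(E^{⊗D})` is detected
  on highest-weight vectors" in the computation of `GL(E)`-invariants of
  `𝕊_π(E^* ⊗ E)` (Gesmundo–Ikenmeyer–Panova 2017, Prop. 22 and Thm. 24).

These are the self-duality inputs of the symmetric-Kronecker bound for the matrix power trace
(`PowerTraceOrbitBound`, Gesmundo–Ikenmeyer–Panova 2017, Thm. 8).

## References

* F. Gesmundo, C. Ikenmeyer, G. Panova, *Geometric complexity theory and matrix powering*,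
  Diff. Geom. Appl. 55 (2017) 106–127 = arXiv:1611.00827, §4 (Prop. 22, Lemma 23, Thm. 24).
  [GesmundoIkenmeyerPanova2017]
* G. D. James, *The Representation Theory of the Symmetric Groups*, LNM 682 (1978), 4.3–4.5
  (polytabloids, `⟨e_t, e_t⟩`), Thm. 4.12. [JamesLNM682]
* W. Fulton, J. Harris, *Representation Theory*, GTM 129 (1991), §15.3, §15.5 (highest weights
  of `GL_n`), Thm. 6.3. [FultonHarrisGTM129]

## Mathlib and tree

Used from Mathlib: `dotProduct` (`Matrix.dotProduct_mulVec`, `Matrix.mulVec_transpose`),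
`Subrepresentation`, `Representation.IsIrreducible` (= `IsSimpleOrder (Subrepresentation ρ)`),
`LinearMap.exists_leftInverse_of_injective`, `Matrix.mulVecLin`. From the tree: `wordRep`,
`wordPerm`, `tensorPowerMatrix`, `compPerm`, `transposeGL`, `spechtEquivHw`,
`isIrreducible_spechtRep_holds`, `StdFilling.polytabloid` (`polytabloid_mem`,
`polytabloid_apply`, `eq_one_of_rowWord_comp_eq`), `exists_hasHighestWeight_of_isRationalRep`,
`isPolynomial_of_hasHighestWeight_glTensorRep`, `size_eq_of_hasHighestWeight_glTensorRep`,
`Weight.existsUnique_eq_ofPartition_holds`.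

## Design

`namespace Literature.NumberTheory.DiophantineGeometry`; `k` a field, `CharZero` where the
Specht theory or the support argument needs it, `Infinite` for the existence theorem.
`IsGLCommuting k M` is stated with matrices (`g^{⊗D} M = M g^{⊗D}`) because downstream the matrix
`M` arises as the coefficient matrix of a fixed vector of `(E ⊗ F)^{⊗D}`.
-/

noncomputable section

open scoped BigOperators Matrix

namespace Literature.NumberTheory.DiophantineGeometry

/-! ### The dot product: invariance and adjoints -/

section DotProduct

variable (k : Type*) [Field k] {N D : ℕ}

/-- The dot product on functions of words is invariant under the permutations of the positions
(a permutation of the coordinates). [folklore] -/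
theorem dotProduct_wordPerm (τ : Equiv.Perm (Fin D)) (x y : Word N D → k) :
    wordPerm k τ x ⬝ᵥ wordPerm k τ y = x ⬝ᵥ y := by
  simp only [dotProduct, wordPerm_apply]
  exact Fintype.sum_equiv (compPerm τ) _ _ fun w => rfl

/-- The Kronecker power of a transpose is the transpose of the Kronecker power. [folklore] -/
theorem tensorPowerMatrix_transpose (g : Matrix (Fin N) (Fin N) k) :
    tensorPowerMatrix k N D gᵀ = (tensorPowerMatrix k N D g)ᵀ := by
  ext w w'
  simp [tensorPowerMatrix_apply, Matrix.transpose_apply]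

/-- The word-model action is multiplication by the Kronecker power (unfolding lemma).
[folklore] -/
theorem wordRep_eq_mulVec (g : GL (Fin N) k) (x : Word N D → k) :
    wordRep k N D g x = tensorPowerMatrix k N D (g : Matrix (Fin N) (Fin N) k) *ᵥ x :=
  rfl

/-- **The adjoint of `g` for the dot product is `gᵀ`**: `⟨g · x, y⟩ = ⟨x, gᵀ · y⟩`.
Fulton–Harris §15.3 (contragredient and transpose). [folklore] -/
theorem dotProduct_wordRep (g : GL (Fin N) k) (x y : Word N D → k) :
    wordRep k N D g x ⬝ᵥ y = x ⬝ᵥ wordRep k N D (transposeGL k g) y := by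
  rw [wordRep_eq_mulVec, wordRep_eq_mulVec, coe_transposeGL, tensorPowerMatrix_transpose,
    dotProduct_comm, Matrix.dotProduct_mulVec, ← Matrix.mulVec_transpose, dotProduct_comm]

end DotProduct

/-! ### Nondegeneracy of the dot product on `HW_μ` -/

section Nondeg

variable (k : Type*) [Field k] [CharZero k] {N D : ℕ}

omit [CharZero k] in
/-- The square of a coefficient of a polytabloid `e_T = ∑_{σ ∈ C_T} sgn(σ) e_{w_T ∘ σ⁻¹}`:
it is `1` on the words `w_T ∘ σ⁻¹`, `σ ∈ C_T` (distinct `σ` give distinct words, as a filling is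
injective on cells), and `0` elsewhere. James, LNM 682, 4.3 (the tabloids involved in `e_t` have
coefficient `±1`). [cite: JamesLNM682, 4.3] -/
theorem StdFilling.polytabloid_apply_mul_self {Y : YoungDiagram} (hN : ∀ x ∈ Y.cells, x.1 < N)
    (T : StdFilling D Y) (w : Word N D) :
    T.polytabloid k hN w * T.polytabloid k hN w =
      if ∃ σ ∈ T.colStab, w = T.rowWord hN ∘ ⇑σ⁻¹ then 1 else 0 := by
  classical
  split_ifs with h
  · obtain ⟨σ, hσ, rfl⟩ := h
    have hval : T.polytabloid k hN (T.rowWord hN ∘ ⇑σ⁻¹) = ((Equiv.Perm.sign σ : ℤ) : k) := by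
      rw [StdFilling.polytabloid_apply, Finset.sum_eq_single_of_mem σ hσ]
      · rw [if_pos rfl]
      · intro σ' hσ' hne
        rw [if_neg]
        intro heq
        apply hne
        have hmem : σ'⁻¹ * σ ∈ T.colStab :=
          StdFilling.mul_mem_colStab (StdFilling.inv_mem_colStab hσ') hσ
        have hfix : T.rowWord hN ∘ ⇑(σ'⁻¹ * σ) = T.rowWord hN := by
          rw [Equiv.Perm.coe_mul, ← Function.comp_assoc, ← heq, Function.comp_assoc,
            ← Equiv.Perm.coe_mul, inv_mul_cancel, Equiv.Perm.coe_one, Function.comp_id]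
        have h1 := T.eq_one_of_rowWord_comp_eq hN hmem hfix
        rw [inv_mul_eq_one] at h1
        exact h1
    rw [hval, ← Int.cast_mul, ← Units.val_mul, Int.units_mul_self, Units.val_one, Int.cast_one]
  · have hval : T.polytabloid k hN w = 0 := by
      rw [StdFilling.polytabloid_apply]
      exact Finset.sum_eq_zero fun σ hσ => if_neg fun heq => h ⟨σ, hσ, heq⟩
    rw [hval, mul_zero]

/-- **`⟨e_T, e_T⟩ = |C_T| ≠ 0`** in characteristic zero: the self-pairing of a polytabloid is the
number of words in its support, which contains the row word. James, LNM 682, 4.3–4.5.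
[cite: JamesLNM682, 4.5] -/
theorem StdFilling.polytabloid_dotProduct_self_ne_zero {Y : YoungDiagram}
    (hN : ∀ x ∈ Y.cells, x.1 < N) (T : StdFilling D Y) :
    T.polytabloid k hN ⬝ᵥ T.polytabloid k hN ≠ 0 := by
  classical
  simp only [dotProduct, StdFilling.polytabloid_apply_mul_self, Finset.sum_boole, Nat.cast_ne_zero]
  apply Finset.card_ne_zero_of_mem (a := T.rowWord hN)
  simp only [Finset.mem_filter, Finset.mem_univ, true_and]
  exact ⟨1, T.one_mem_colStab, by simp⟩

variable {k}

/-- The highest-weight space `HW_μ` of the word model contains a vector with nonzero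
self-pairing: the polytabloid of the row-reading tableau of `μ` (`StdFilling.polytabloid_mem`).
Fulton, *Young Tableaux*, §8.2 Lemma 4; James 4.3. [cite: JamesLNM682, 4.3] -/
theorem exists_mem_highestWeightSpace_dotProduct_self_ne_zero (μ : Nat.Partition D)
    (hμ : μ.parts.card ≤ N) :
    ∃ v ∈ highestWeightSpace (wordRep k N D) (Weight.ofPartition N μ), v ⬝ᵥ v ≠ 0 := by
  refine ⟨(StdFilling.rowReading μ).polytabloid k (forall_fst_lt_of_card_le μ hμ), ?_,
    StdFilling.polytabloid_dotProduct_self_ne_zero k _ _⟩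
  rw [← ydWeight_youngDiagram]
  exact (StdFilling.rowReading μ).polytabloid_mem _ μ.card_cells_youngDiagram

/-- **The dot product is nondegenerate on `HW_μ((k^N)^{⊗D})`** (`μ ⊢ D` with at most `N` parts,
characteristic zero): a highest-weight vector of weight `μ` orthogonal to all of `HW_μ`
vanishes. The radical of the restricted (`𝔖_D`-invariant) form, pulled back along the
`𝔖_D`-isomorphism `S^μ ≃ HW_μ` (`spechtEquivHw`), is a subrepresentation of the irreducible
Specht module (`isIrreducible_spechtRep_holds`), hence `0` or everything, and it is not
everything by `exists_mem_highestWeightSpace_dotProduct_self_ne_zero`. (Equivalently: `S^μ`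
carries a nondegenerate invariant symmetric form; James, LNM 682, 4.3–4.5 and Thm. 4.12.)
[cite: JamesLNM682, Theorem 4.12] -/
theorem eq_zero_of_forall_dotProduct_eq_zero (μ : Nat.Partition D) (hμ : μ.parts.card ≤ N)
    {x : Word N D → k} (hx : x ∈ highestWeightSpace (wordRep k N D) (Weight.ofPartition N μ))
    (h : ∀ y ∈ highestWeightSpace (wordRep k N D) (Weight.ofPartition N μ), x ⬝ᵥ y = 0) :
    x = 0 := by
  classical
  set HW := highestWeightSpace (wordRep k N D) (Weight.ofPartition N μ) with hHW
  set e := spechtEquivHw k μ hμ with he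
  haveI : (spechtRep k μ).IsIrreducible := isIrreducible_spechtRep_holds μ
  -- the radical, pulled back to the Specht module
  let R : Subrepresentation (spechtRep k μ) :=
    { toSubmodule :=
        { carrier := {z | ∀ y ∈ HW, ((e.toLinearEquiv z : HW) : Word N D → k) ⬝ᵥ y = 0}
          add_mem' := fun {a b} ha hb y hy => by
            rw [map_add, Submodule.coe_add, add_dotProduct, ha y hy, hb y hy, add_zero]
          zero_mem' := fun y hy => by rw [map_zero, Submodule.coe_zero, zero_dotProduct]
          smul_mem' := fun c a ha y hy => by
            rw [map_smul, Submodule.coe_smul, smul_dotProduct, ha y hy, smul_zero] }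
      apply_mem_toSubmodule := fun g z hz y hy => by
        change ((e.toLinearEquiv (spechtRep k μ g z) : HW) : Word N D → k) ⬝ᵥ y = 0
        rw [Representation.Equiv.toLinearEquiv_apply, e.toIntertwiningMap.isIntertwining,
          coe_hwPermRep_apply, ← Representation.Equiv.toLinearEquiv_apply]
        have hy' : wordPerm k g⁻¹ y ∈ HW := wordPerm_mem_highestWeightSpace g⁻¹ hy
        have := hz _ hy'
        rwa [← dotProduct_wordPerm k g, ← LinearMap.comp_apply, ← wordPerm_mul, mul_inv_cancel,
          wordPerm_one, LinearMap.id_apply] at this }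
  rcases eq_bot_or_eq_top R with hR | hR
  · -- the radical is zero
    have hR' : R.toSubmodule = ⊥ := congrArg Subrepresentation.toSubmodule hR
    set z := e.toLinearEquiv.symm ⟨x, hx⟩ with hz
    have hzR : z ∈ R.toSubmodule := fun y hy => by
      rw [hz, LinearEquiv.apply_symm_apply]
      exact h y hy
    rw [hR', Submodule.mem_bot] at hzR
    have : (⟨x, hx⟩ : HW) = 0 := by
      rw [← e.toLinearEquiv.apply_symm_apply ⟨x, hx⟩, ← hz, hzR, map_zero]
    exact congrArg Subtype.val this
  · -- the radical is everything: contradicts `⟨e_T, e_T⟩ ≠ 0`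
    exfalso
    obtain ⟨v, hv, hvv⟩ := exists_mem_highestWeightSpace_dotProduct_self_ne_zero (k := k) μ hμ
    have hR' : R.toSubmodule = ⊤ := congrArg Subrepresentation.toSubmodule hR
    have hmem : e.toLinearEquiv.symm ⟨v, hv⟩ ∈ R.toSubmodule := by
      rw [hR']; exact Submodule.mem_top
    have := hmem v hv
    rw [LinearEquiv.apply_symm_apply] at this
    exact hvv this

end Nondeg

/-! ### Highest-weight vectors of stable subspaces; the weights are partitions -/

section Existence

variable (k : Type*) [Field k] {N D : ℕ}

open MvPolynomial in
/-- **The word model is a polynomial representation**: the matrix coefficient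
`g ↦ φ(g · v)` is the polynomial `∑_{w', w} φ(e_{w'}) v(w) ∏_p X_{w' p, w p}` in the entries of
`g`. Green, LNM 830, §2.2 ((2.6a): tensor powers of the natural module are polynomial);
Fulton–Harris §15.5. [folklore] -/
theorem isPolynomialRep_wordRep : IsPolynomialRep (wordRep k N D) := by
  classical
  intro v φ
  refine ⟨∑ w' : Word N D, ∑ w : Word N D,
    C (φ (Pi.single w' 1) * v w) * ∏ p, X ((w' p, w p) : Fin N × Fin N), fun g => ?_⟩
  have hexp : wordRep k N D g v =
      ∑ w', wordRep k N D g v w' • (Pi.single w' (1 : k) : Word N D → k) :=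
    pi_eq_sum_univ' _
  rw [hexp, map_sum, map_sum]
  refine Finset.sum_congr rfl fun w' _ => ?_
  rw [map_smul, smul_eq_mul, wordRep_apply, map_sum, Finset.sum_mul]
  refine Finset.sum_congr rfl fun w _ => ?_
  simp only [map_mul, eval_C, map_prod, eval_X]
  ring

variable {k}

/-- **Nonzero `GL_N`-stable subspaces of the word model contain highest-weight vectors** (over an
infinite field): the subrepresentation on a stable `U ≠ 0` is polynomial (its matrix
coefficients are matrix coefficients of `wordRep`, through a left inverse of the inclusion), so
the existence theorem `exists_hasHighestWeight_of_isRationalRep` (Goodman–Wallach Cor. 3.2.3,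
existence part; Lie–Kolchin) applies. [cite: GoodmanWallachGTM255, Cor. 3.2.3 (proof)] -/
theorem exists_mem_highestWeightSpace_of_le_comap [Infinite k] (U : Submodule k (Word N D → k))
    (hU : ∀ g, U ≤ U.comap (wordRep k N D g)) (hU0 : U ≠ ⊥) :
    ∃ χ : Weight (Fin N), ∃ v ∈ U, v ≠ 0 ∧ v ∈ highestWeightSpace (wordRep k N D) χ := by
  set ρU := (wordRep k N D).subrepresentation U hU with hρU
  haveI : Nontrivial U := Submodule.nontrivial_iff_ne_bot.mpr hU0
  obtain ⟨π, hπ⟩ := LinearMap.exists_leftInverse_of_injective U.subtype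
    (LinearMap.ker_eq_bot.mpr U.injective_subtype)
  have hrat : IsRationalRep ρU := by
    refine IsPolynomialRep.isRationalRep fun u φ => ?_
    obtain ⟨P, hP⟩ := isPolynomialRep_wordRep k (N := N) (D := D) (u : Word N D → k) (φ ∘ₗ π)
    refine ⟨P, fun g => ?_⟩
    rw [← hP g, LinearMap.comp_apply]
    congr 1
    have := LinearMap.congr_fun hπ (ρU g u)
    rw [LinearMap.comp_apply, LinearMap.id_apply] at this
    rw [← this]
    rfl
  obtain ⟨χ, hχ⟩ := exists_hasHighestWeight_of_isRationalRep ρU hrat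
  obtain ⟨v, hv0, hv⟩ := (hasHighestWeight_iff_exists _ _).mp hχ
  refine ⟨χ, v, v.2, fun h0 => hv0 (Subtype.ext h0), fun b hb => ?_⟩
  exact congrArg Subtype.val (hv b hb)

/-- **The highest weights of the word model are partitions**: if `HW_χ((k^N)^{⊗D}) ≠ 0`
(characteristic zero) then `χ = Weight.ofPartition N μ` for a partition `μ ⊢ D` with at most `N`
parts (`χ` is a polynomial dominant weight of size `D`:
`isPolynomial_of_hasHighestWeight_glTensorRep`, `size_eq_of_hasHighestWeight_glTensorRep`,
`Weight.existsUnique_eq_ofPartition_holds`). Fulton–Harris Thm. 6.3 (2) with Prop. 15.15;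
Green Thm. (3.5a). [cite: FultonHarrisGTM129, Thm. 6.3 (2) with Prop. 15.15] -/
theorem exists_partition_of_highestWeightSpace_ne_bot [CharZero k] {χ : Weight (Fin N)}
    (h : highestWeightSpace (wordRep k N D) χ ≠ ⊥) :
    ∃ μ : Nat.Partition D, μ.parts.card ≤ N ∧ Weight.ofPartition N μ = χ := by
  have h' : HasHighestWeight (glTensorRep (Fin N) k D) χ := by
    rw [hasHighestWeight_congr (wordRepEquiv k N D)]
    exact h
  have hpol := isPolynomial_of_hasHighestWeight_glTensorRep h'
  have hsize := size_eq_of_hasHighestWeight_glTensorRep h'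
  obtain ⟨μ, ⟨hμ, hμχ⟩, -⟩ := Weight.existsUnique_eq_ofPartition_holds hpol
  have hD : χ.size.toNat = D := by rw [hsize, Int.toNat_natCast]
  subst hD
  exact ⟨μ, hμ, hμχ⟩

end Existence

/-! ### Symmetric matrices on words commuting with `GL_N` -/

section Commutant

variable {k : Type*} [Field k] {N D : ℕ}

/-- A matrix on words *commutes with `GL_N`* if `g^{⊗D} M = M g^{⊗D}` for every invertible `g`
(the matrices of `End_{GL(E)}(E^{⊗D})` in the word basis). Gesmundo–Ikenmeyer–Panova §4
(Prop. 22: `GL(E)`-invariants of `(E^* ⊗ E)^{⊗d}`); Fulton–Harris §6.2 (Lemma 6.22, the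
commutant). [cite: GesmundoIkenmeyerPanova2017, §4 Prop. 22] -/
def IsGLCommuting (k : Type*) [Field k] (M : Matrix (Word N D) (Word N D) k) : Prop :=
  ∀ g : GL (Fin N) k, tensorPowerMatrix k N D (g : Matrix (Fin N) (Fin N) k) * M =
    M * tensorPowerMatrix k N D (g : Matrix (Fin N) (Fin N) k)

/-- A commuting matrix commutes with the action on vectors: `M (g · x) = g · (M x)`.
[folklore] -/
theorem IsGLCommuting.mulVec_wordRep {M : Matrix (Word N D) (Word N D) k} (hM : IsGLCommuting k M)
    (g : GL (Fin N) k) (x : Word N D → k) :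
    M *ᵥ wordRep k N D g x = wordRep k N D g (M *ᵥ x) := by
  rw [wordRep_eq_mulVec, wordRep_eq_mulVec, Matrix.mulVec_mulVec, Matrix.mulVec_mulVec, hM g]

/-- A commuting matrix preserves every highest-weight space (it commutes with the Borel
subgroup). Goodman–Wallach §3.2.1. [folklore] -/
theorem IsGLCommuting.mulVec_mem_highestWeightSpace {M : Matrix (Word N D) (Word N D) k}
    (hM : IsGLCommuting k M) {χ : Weight (Fin N)} {x : Word N D → k}
    (hx : x ∈ highestWeightSpace (wordRep k N D) χ) :
    M *ᵥ x ∈ highestWeightSpace (wordRep k N D) χ := fun b hb => by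
  rw [← hM.mulVec_wordRep, hx b hb, Matrix.mulVec_smul]

/-- A symmetric matrix is self-adjoint for the dot product: `⟨M x, y⟩ = ⟨x, M y⟩`. [folklore] -/
theorem dotProduct_mulVec_of_transpose_eq {M : Matrix (Word N D) (Word N D) k} (hMt : Mᵀ = M)
    (x y : Word N D → k) : M *ᵥ x ⬝ᵥ y = x ⬝ᵥ M *ᵥ y := by
  conv_lhs => rw [dotProduct_comm, Matrix.dotProduct_mulVec, ← Matrix.mulVec_transpose, hMt,
    dotProduct_comm]

/-- **A nonzero symmetric `GL_N`-commuting matrix moves a highest-weight vector**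
(characteristic zero): for `M ≠ 0` symmetric with `g^{⊗D} M = M g^{⊗D}`, some `x ∈ HW_μ`, `μ ⊢ D`
with at most `N` parts, has `M x ≠ 0`. Indeed the range of `M` is a nonzero stable subspace,
hence contains a nonzero highest-weight vector `v = M y` of some weight, necessarily a
partition `μ` (`exists_partition_of_highestWeightSpace_ne_bot`); if `M` killed `HW_μ` then
`⟨v, x⟩ = ⟨y, M x⟩ = 0` for all `x ∈ HW_μ`, so `v = 0` by nondegeneracy
(`eq_zero_of_forall_dotProduct_eq_zero`). This is the part of "`[𝕊_π(E^* ⊗ E)]^{GL(E)}` is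
computed summand by summand on `⊕ K ⊗ 𝕊_μE^* ⊗ 𝕊_νE`" (GIP Prop. 22) that an upper bound
needs. [cite: GesmundoIkenmeyerPanova2017, §4 Prop. 22] -/
theorem IsGLCommuting.exists_mulVec_ne_zero [CharZero k] {M : Matrix (Word N D) (Word N D) k}
    (hM : IsGLCommuting k M) (hMt : Mᵀ = M) (hM0 : M ≠ 0) :
    ∃ μ : Nat.Partition D, μ.parts.card ≤ N ∧
      ∃ x ∈ highestWeightSpace (wordRep k N D) (Weight.ofPartition N μ), M *ᵥ x ≠ 0 := by
  classical
  set U : Submodule k (Word N D → k) := LinearMap.range M.mulVecLin with hUdef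
  have hU : ∀ g, U ≤ U.comap (wordRep k N D g) := by
    rintro g _ ⟨y, rfl⟩
    rw [Submodule.mem_comap, Matrix.mulVecLin_apply, ← hM.mulVec_wordRep]
    exact ⟨_, rfl⟩
  have hU0 : U ≠ ⊥ := by
    intro hbot
    apply hM0
    ext i j
    have hj : M *ᵥ Pi.single j 1 ∈ U := ⟨_, rfl⟩
    rw [hbot, Submodule.mem_bot] at hj
    have := congr_fun hj i
    rw [Matrix.mulVec_single_one] at this
    exact this
  obtain ⟨χ, v, ⟨y, rfl⟩, hv0, hv⟩ := exists_mem_highestWeightSpace_of_le_comap U hU hU0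
  rw [Matrix.mulVecLin_apply] at hv0 hv
  have hne : highestWeightSpace (wordRep k N D) χ ≠ ⊥ := by
    rw [Submodule.ne_bot_iff]
    exact ⟨_, hv, hv0⟩
  obtain ⟨μ, hμ, rfl⟩ := exists_partition_of_highestWeightSpace_ne_bot hne
  refine ⟨μ, hμ, ?_⟩
  by_contra hall
  push Not at hall
  apply hv0
  refine eq_zero_of_forall_dotProduct_eq_zero μ hμ hv fun x hx => ?_
  rw [dotProduct_mulVec_of_transpose_eq hMt, hall x hx, dotProduct_zero]

end Commutant

end Literature.NumberTheory.DiophantineGeometry
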